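import Summits.RiemannHypothesis.RiemannHypothesis.Theorems.ConnesConsaniSemilocalDensityRegular
import Summits.RiemannHypothesis.RiemannHypothesis.Theorems.ConnesConsaniSemilocalSoninTraceFormula
import Summits.RiemannHypothesis.RiemannHypothesis.Theorems.ConnesConsaniSemilocalDensitySlope
import Summits.RiemannHypothesis.RiemannHypothesis.Theorems.ConnesConsaniSemilocalWindowSpectralBound
import Summits.RiemannHypothesis.RiemannHypothesis.Theorems.ConnesConsaniSemilocalAssembly
import HarnessLib

/-!
# Route «ConnesConsaniSemilocal» (No.10): END-TO-END LEAF CERTIFICATE — the deciding theorem fed by the four closers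

RH-FREE route bookkeeping (cell `rh-crit`, sub-cell `cc/`, seat `rh-crit-cc-iso`; bears_on: W-C/W-P, FRONTIER rung
W-C(C1), ZERO summit credit).  The planner-authored deciding theorem
`Theses.ConnesConsaniSemilocal.closes : DensityRegular → SoninTraceFormula → DensitySlope → WindowSpectralBound →
WeilArchPositivity_soninTrace_fine` applied to the four landed, UNCONDITIONAL item closers BY NAME:
K0 `densityRegular_proof` (stmt-RiemannHypothesis-19307), K1 `soninTraceFormula_proof` (-19305),
K2 `densitySlope_proof` (-19308), K3 `windowSpectralBound_proof` (-19306) — the D-0059 composition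
«closes = discharged corpus theorems» kernel-checked in ONE declaration whose type is literally the route's
`closes_target`, the registered rung leaf `Literature.NumberTheory.ConnesConsani2021.WeilArchPositivity_soninTrace_fine`
(Connes–Consani 2021, eq. (4) / Thm. 6.11).  The same leaf is ALSO a tree theorem on the Literature side
(`WeilArchPositivity_soninTrace_fine_holds`, module `ArchimedeanPositivityOfEnclosures`, which assembles the corpus
theorems directly); this file records that the ROUTE, as filed, closes it.  Also recorded: the assembly item
(stmt-RiemannHypothesis-19310) composed with the leaf, i.e. the route's full statement «leaf ∧ (IsolatedCC → RH)»,
and the residual's RH-equivalence by the cited kernel (`CCIsolation.isolatedCC_iff_summit`).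
No defs, no facts, standard axioms.
WHAT THIS IS NOT: a proof of, evidence for, or any statement about RH — the leaf is an RH-FREE archimedean
positivity statement (NOT RH-detecting); the route's declared residual `IsolatedCC = ∀ n, P(n)` is RH-EQUIVALENT
(line 1 of its docstring) and is untouched here; nothing in this file bears on the truth of RH.
-/

set_option linter.dupNamespace false  -- the mandated namespace repeats `RiemannHypothesis`

namespace Summit.RiemannHypothesis.RiemannHypothesis.Theorems.ConnesConsaniSemilocalLeaf

open Summit.RiemannHypothesis.RiemannHypothesis.Theses

/-- RH-FREE. **The route's leaf, by the route**: Connes–Consani 2021 eq. (4) / Thm. 6.11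
(`WeilArchPositivity_soninTrace_fine`: `∃ c < 17`, `W_∞(g∗g*) ≥ Tr(ϑ(g)𝐒ϑ(g)*) − c|ĝ(0)|²` for `g` on
`[2^{−1/2}, 2^{1/2}]` with `ĝ(i/2) = 0`, weak-trace typing) obtained as `closes K0 K1 K2 K3` from the four item
closers of route No.10.  NOT RH-detecting. [cite: ConnesConsani2021, eq. (4) (Intro p. 4); Thm. 6.11 §6.7 pp. 28–29] -/
theorem leaf_proof : Literature.NumberTheory.ConnesConsani2021.WeilArchPositivity_soninTrace_fine :=
  ConnesConsaniSemilocal.closes ConnesConsaniSemilocalDensityRegular.densityRegular_proof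
    ConnesConsaniSemilocalSoninTraceFormula.soninTraceFormula_proof
    ConnesConsaniSemilocalDensitySlope.densitySlope_proof
    ConnesConsaniSemilocalWindowSpectralBound.windowSpectralBound_proof

/-- RH-FREE conjunction (its second conjunct is an implication from an RH-EQUIVALENT hypothesis; nothing about RH is
asserted): the route's complete statement of record — the rung leaf HOLDS, and the assembly item
`Assembly : leaf → IsolatedCC → Summit.RiemannHypothesis` HOLDS (`assembly_proof`), so what separates the
Connes–Consani corpus from the summit is exactly the declared residual `IsolatedCC`.
[cite: ConnesConsani2021, eq. (4) (Intro p. 4); Connes2026Letter §4.1 p. 17] -/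
theorem leaf_and_assembly :
    Literature.NumberTheory.ConnesConsani2021.WeilArchPositivity_soninTrace_fine ∧
      (ConnesConsaniSemilocal.IsolatedCC → _root_.Summit.RiemannHypothesis) :=
  ⟨leaf_proof, ConnesConsaniSemilocalAssembly.assembly_proof leaf_proof⟩

/-- RH-EQUIVALENT (line 1): the route's declared residual `IsolatedCC` (aside stmt-RiemannHypothesis-19309,
`∀ n, weilPropertyP n`) is equivalent to `Summit.RiemannHypothesis` by the cited kernel
(`CCRouteAdapters.isolatedCC_iff_ccIsolation` then `CCIsolation.isolatedCC_iff_summit` ←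
`ConnesPropertyP.riemannHypothesis_iff_forall_weilPropertyP`); recorded next to the leaf so that the isolation
statement of record reads in one place: leaf PROVED (above), residual ⟺ RH (here), converse direction
`RH → IsolatedCC` included.  An equivalence is not a proof; nothing is asserted about either side.
[cite: Bombieri2000Weil, Thm. 2; Connes2026Letter §4.1 p. 17] -/
theorem residual_iff_summit : ConnesConsaniSemilocal.IsolatedCC ↔ _root_.Summit.RiemannHypothesis :=
  CCRouteAdapters.isolatedCC_iff_ccIsolation.trans CCIsolation.isolatedCC_iff_summit

end Summit.RiemannHypothesis.RiemannHypothesis.Theorems.ConnesConsaniSemilocalLeaf
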